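import Mathlib
import Literature.Probability.Percolation.PercolationProofs
import Literature.Probability.Percolation.PercolationEvents
import Literature.Probability.Percolation.Crossings
import Literature.Probability.Percolation.SharpnessDCTProofs
import Literature.Probability.LatticeModels.ProdBernoulliIndependence
import Literature.Probability.Percolation.ConditionalPositiveAssociation
import Literature.Probability.Percolation.ConditionalPositiveAssociationProofs
import Literature.Probability.Percolation.TwoClusterConditionalAssociation
import Literature.Probability.Percolation.ClusterBoundary
import Literature.Probability.Percolation.PlanarDuality
import Literature.Barriers.CriticalPhenomena.TimarGoodBox
import Summits.CriticalPhenomena.PercolationContinuityZ3.Theorems.PercNearOneGluingAdditiveGluingGoodStepBridge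
import HarnessLib

/-! # Crux `PercNearOneGluing.AdditiveGluing` (stmt-CriticalPhenomena-4576), line `subuniform-dead-pocket-maximum`,
# stub `stub_goodStep` — the |A∖b| = 2 kernel C1 for DOWN-closed pocket families, I: paths and pockets (siege k3)

Helper file for the crux skeleton `Cruxes/AdditiveGluing/Lines/subuniform-dead-pocket-maximum.lean`
(siege on the hardest stub `stub_goodStep`, variation "BHK decomposition of the good step",
prover-siege-stmt-CriticalPhenomena-4576-stub_goodStep-3).  Lands with `--supports stmt-CriticalPhenomena-4576`.
Toolkit for the main file `…GoodStepC1Down.lean` (Theorem C1↓ of the evidence note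
`siege-k3-bhk-decomposition.md`); the mathematics is recalled there.

## Content (deterministic)

For the product measure vocabulary of the crux (`BondConfig (Fin n)`, `openCluster`, `openConn`,
`openConnIn`, `clusterIs o W = {C(o) = W}`):
* §Paths: an open path starting outside `C(s)` never enters it, so for `o ∉ C(s)` the cluster of `o`
  is its cluster INSIDE `C(s)ᶜ` (`c1Down_openCluster_eq_of_notMem`); the vertex set of the open EDGE
  cluster of `s` is `C(s)` (`c1Down_vert_openEdgeCluster`, to feed functions of the vertex set into the
  van den Berg–Häggström–Kahn fact, which is stated for functions of the edge cluster).
* §Pointwise / §PerCluster: on the event `{C(a₂) = U}` the events `{a₂ ↮ a₁}`, `{a₂ ↔ b}`, `{a₁ ↔ b}`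
  and the SANDWICHED OBSERVER EVENT `F_R = {a₁ ∉ C(o)} ∩ ({a₂ ∈ C(o)} ∪ {C(o) ∈ R})` (for a family `R`
  of pockets avoiding `a₁`) are identified with `[a₁ ∉ U]`, `[b ∈ U]`, `{a₁ ↔ b in Uᶜ}` and — for
  `o ∉ U` — the event "the cluster of `o` inside `Uᶜ` is a pocket of `R`"
  (`c1Down_clusterIs_inter_F`); the latter is determined by the pairs inside `Uᶜ`, and for a
  DOWN-closed `R` (closed under `W' ∋ o`, `W' ⊆ W ∈ R`) it is a decreasing event and its probability
  increases with `U` (`c1Down_isLowerSet_rev`, `c1Down_rev_mono`) — the monotonicity that drives C1↓.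
All folklore (Grimmett 1999 §§1.3, 2.2); no new definitions (events written inline).
-/

namespace Summit.CriticalPhenomena.PercolationContinuityZ3.Theorems

open MeasureTheory Set
open Literature.Probability.LatticeModels (prodBernoulli)
open Literature.Probability.Percolation (BondConfig openConn openConnIn openGraph openCluster
  openGraph_adj openEdgeCluster DeterminedBy determinedBy_iff PathIn clusterIs mem_clusterIs
  edgesTouching determinedBy_clusterIs disjoint_edgesTouching_compl_sym2 openConnIn_subset_openConn)

noncomputable section
open Classical

section Paths

variable {V : Type*}

/-- An open path starting outside the open cluster of `s` never enters it: if `x ∉ C(s)` and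
`x ↔ y`, then `x ↔ y` inside the complement of `C(s)`. [folklore] -/
theorem c1Down_openConnIn_compl_of_reachable {ω : BondConfig V} {s x y : V}
    (hx : x ∉ openCluster ω s) (hxy : (openGraph ω).Reachable x y) :
    ω ∈ openConnIn (openCluster ω s)ᶜ x y := by
  apply Literature.Probability.Percolation.DCT16.mem_openConnIn_of_pathIn
  have hp := Literature.Probability.Percolation.DCT16.pathIn_univ_of_reachable hxy
  -- every vertex of the path lies outside `C(s)`
  obtain ⟨-, hr⟩ := hp
  clear hxy
  refine ⟨hx, ?_⟩
  induction hr with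
  | refl => exact Relation.ReflTransGen.refl
  | @tail b c hxb hbc ih =>
    refine ih.tail ⟨hbc.1, fun hc => ?_⟩
    -- `c ∈ C(s)` and `b ∼ c` force `b ∈ C(s)`, and then `x ∈ C(s)` by the path `x ↔ b`
    have hb : b ∈ openCluster ω s := (show (openGraph ω).Reachable s c from hc).trans hbc.1.symm.reachable
    have hxb' : (openGraph ω).Reachable x b :=
      Literature.Probability.Percolation.DCT16.reachable_of_pathIn (A := Set.univ) ⟨Set.mem_univ x, hxb⟩
    exact hx ((show (openGraph ω).Reachable s b from hb).trans hxb'.symm)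

/-- Conversely a path inside any set is a path. [folklore] -/
theorem c1Down_reachable_of_openConnIn {ω : BondConfig V} {S : Set V} {x y : V}
    (h : ω ∈ openConnIn S x y) : (openGraph ω).Reachable x y :=
  Literature.Probability.Percolation.DCT16.reachable_of_pathIn
    (Literature.Probability.Percolation.DCT16.pathIn_of_mem_openConnIn h)

/-- For `o ∉ C(s)`, the open cluster of `o` is its open cluster inside the complement of `C(s)`.
[folklore] -/
theorem c1Down_openCluster_eq_of_notMem {ω : BondConfig V} {s o : V} (ho : o ∉ openCluster ω s) :
    openCluster ω o = {y | ω ∈ openConnIn (openCluster ω s)ᶜ o y} := by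
  ext y
  exact ⟨fun hy => c1Down_openConnIn_compl_of_reachable ho hy,
    fun hy => c1Down_reachable_of_openConnIn hy⟩

/-- The cluster of `x` inside `S` is antitone... more precisely MONOTONE in `S`: a path inside a
smaller set is a path inside a bigger one. [folklore] -/
theorem c1Down_openConnIn_mono_set {S T : Set V} (hST : S ⊆ T) {ω : BondConfig V} {x y : V}
    (h : ω ∈ openConnIn S x y) : ω ∈ openConnIn T x y :=
  Literature.Probability.Percolation.DCT16.mem_openConnIn_of_pathIn
    ((Literature.Probability.Percolation.DCT16.pathIn_of_mem_openConnIn h).mono hST)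

/-- The vertex set of the open edge cluster of `s` (together with `s`) is the open cluster of `s`.
[folklore] -/
theorem c1Down_vert_openEdgeCluster (ω : BondConfig V) (s : V) :
    {v : V | v = s ∨ ∃ e ∈ openEdgeCluster ω s, v ∈ e} = openCluster ω s := by
  ext v
  simp only [Set.mem_setOf_eq]
  rw [show v ∈ openCluster ω s ↔ (openGraph ω).Reachable s v from Iff.rfl,
    Literature.Probability.Percolation.reachable_iff_exists_mem_openEdgeCluster]

end Paths

section Pointwise

variable {V : Type*}

/-- A path inside `S` ends in `S`: the cluster of `x` inside `S` is contained in `S`. [folklore] -/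
theorem c1Down_mem_of_openConnIn {ω : BondConfig V} {S : Set V} {x y : V}
    (h : ω ∈ openConnIn S x y) : y ∈ S := by
  obtain ⟨-, hy, -⟩ := h
  exact hy

/-- An event defined through the membership pattern of a family of events determined by `K` is
determined by `K`. [folklore] -/
theorem c1Down_determinedBy_pattern {ι α : Type*} {E : α → Set (Set ι)} {K : Set ι}
    (hE : ∀ y, DeterminedBy (E y) K) (P : (α → Prop) → Prop) :
    DeterminedBy {ω | P fun y => ω ∈ E y} K := by
  rw [determinedBy_iff]
  intro ω ω' h
  have key : (fun y => ω ∈ E y) = fun y => ω' ∈ E y :=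
    funext fun y => propext ((determinedBy_iff _ _).1 (hE y) ω ω' h)
  simp only [Set.mem_setOf_eq, key]

end Pointwise

section PerCluster

variable {n : ℕ}

/-! ### Pointwise identifications on `{C(a₂) = U}` -/

/-- On `{C(a₂) = U}`: `a₂ ↮ a₁` iff `a₁ ∉ U`. [folklore] -/
theorem c1Down_clusterIs_inter_D (a₂ a₁ : Fin n) (U : Finset (Fin n)) :
    clusterIs a₂ U ∩ (openConn a₂ a₁)ᶜ =
      if a₁ ∈ U then ∅ else clusterIs a₂ U := by
  ext ω
  simp only [Set.mem_inter_iff, Set.mem_compl_iff]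
  split_ifs with h
  · simp only [Set.mem_empty_iff_false, iff_false, not_and, not_not]
    intro hω
    rw [mem_clusterIs] at hω
    have : a₁ ∈ openCluster ω a₂ := by rw [hω]; exact_mod_cast h
    exact this
  · constructor
    · exact fun hh => hh.1
    · intro hω
      refine ⟨hω, fun h1 => h ?_⟩
      rw [mem_clusterIs] at hω
      have : a₁ ∈ openCluster ω a₂ := h1
      rw [hω] at this
      exact_mod_cast this

/-- On `{C(a₂) = U}`: `a₂ ↔ b` iff `b ∈ U`. [folklore] -/
theorem c1Down_clusterIs_inter_openConn_self (a₂ b : Fin n) (U : Finset (Fin n)) :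
    clusterIs a₂ U ∩ openConn a₂ b = if b ∈ U then clusterIs a₂ U else ∅ := by
  ext ω
  simp only [Set.mem_inter_iff]
  split_ifs with h
  · constructor
    · exact fun hh => hh.1
    · intro hω
      refine ⟨hω, ?_⟩
      rw [mem_clusterIs] at hω
      have : b ∈ openCluster ω a₂ := by rw [hω]; exact_mod_cast h
      exact this
  · simp only [Set.mem_empty_iff_false, iff_false, not_and]
    intro hω hb
    rw [mem_clusterIs] at hω
    have : b ∈ openCluster ω a₂ := hb
    rw [hω] at this
    exact h (by exact_mod_cast this)

/-- On `{C(a₂) = U}` with `b ∈ U` and `a₁ ∉ U`, `a₁ ↮ b`. [folklore] -/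
theorem c1Down_clusterIs_inter_openConn_eq_empty (a₂ a₁ b : Fin n) (U : Finset (Fin n))
    (hb : b ∈ U) (ha : a₁ ∉ U) : clusterIs a₂ U ∩ openConn a₁ b = ∅ := by
  ext ω
  simp only [Set.mem_inter_iff, Set.mem_empty_iff_false, iff_false, not_and]
  intro hω h1
  rw [mem_clusterIs] at hω
  have hb' : (openGraph ω).Reachable a₂ b := by
    have : b ∈ openCluster ω a₂ := by rw [hω]; exact_mod_cast hb
    exact this
  have : a₁ ∈ openCluster ω a₂ := hb'.trans (show (openGraph ω).Reachable a₁ b from h1).symm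
  rw [hω] at this
  exact ha (by exact_mod_cast this)

/-- On `{C(a₂) = U}` with `o ∈ U` and `a₁ ∉ U`, the sandwiched event holds (`C(o) = C(a₂) = U`).
[folklore] -/
theorem c1Down_clusterIs_subset_F (a₂ a₁ o : Fin n) (U : Finset (Fin n))
    (R : Finset (Finset (Fin n))) (ho : o ∈ U) (ha : a₁ ∉ U) :
    clusterIs a₂ U ⊆ {ω : BondConfig (Fin n) | a₁ ∉ openCluster ω o ∧
      (a₂ ∈ openCluster ω o ∨ ∃ W ∈ R, openCluster ω o = ↑W)} := by
  intro ω hω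
  rw [mem_clusterIs] at hω
  have hoU : o ∈ openCluster ω a₂ := by rw [hω]; exact_mod_cast ho
  have hKo : openCluster ω o = ↑U := by rw [Literature.Barriers.CriticalPhenomena.openCluster_eq_openCluster_of_mem hoU, hω]
  refine ⟨fun h1 => ha ?_, Or.inl ?_⟩
  · rw [hKo] at h1; exact_mod_cast h1
  · rw [hKo, ← hω]; exact Literature.Probability.Percolation.mem_openCluster_self ω a₂

/-- On `{C(a₂) = U}` with `o ∉ U`, the open cluster of `o` is its cluster inside `Uᶜ`. [folklore] -/
theorem c1Down_openCluster_obs_eq (a₂ o : Fin n) (U : Finset (Fin n)) {ω : BondConfig (Fin n)}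
    (hω : ω ∈ clusterIs a₂ U) (ho : o ∉ U) :
    openCluster ω o = {y | ω ∈ openConnIn ((↑U : Set (Fin n))ᶜ) o y} := by
  rw [mem_clusterIs] at hω
  have ho' : o ∉ openCluster ω a₂ := by rw [hω]; exact_mod_cast ho
  rw [c1Down_openCluster_eq_of_notMem ho', hω]

/-- On `{C(a₂) = U}` with `o ∉ U` (and pockets avoiding `a₁`), the sandwiched event is the event
"the cluster of `o` inside `Uᶜ` is a pocket of `R`". [folklore] -/
theorem c1Down_clusterIs_inter_F (a₂ a₁ o : Fin n) (U : Finset (Fin n))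
    (R : Finset (Finset (Fin n))) (hR : ∀ W ∈ R, a₁ ∉ W) (ho : o ∉ U) :
    clusterIs a₂ U ∩ {ω : BondConfig (Fin n) | a₁ ∉ openCluster ω o ∧
      (a₂ ∈ openCluster ω o ∨ ∃ W ∈ R, openCluster ω o = ↑W)} =
    clusterIs a₂ U ∩ {ω | ∃ W ∈ R, ∀ y : Fin n, ω ∈ openConnIn ((↑U : Set (Fin n))ᶜ) o y ↔ y ∈ W} := by
  ext ω
  simp only [Set.mem_inter_iff, Set.mem_setOf_eq]
  constructor
  · rintro ⟨hω, h1, h2⟩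
    refine ⟨hω, ?_⟩
    have hK := c1Down_openCluster_obs_eq a₂ o U hω ho
    rcases h2 with h2 | ⟨W, hW, hKW⟩
    · exfalso
      rw [hK] at h2
      have : a₂ ∈ ((↑U : Set (Fin n))ᶜ) := c1Down_mem_of_openConnIn h2
      rw [mem_clusterIs] at hω
      have h' : a₂ ∈ openCluster ω a₂ := Literature.Probability.Percolation.mem_openCluster_self ω a₂
      rw [hω] at h'
      exact this h'
    · refine ⟨W, hW, fun y => ?_⟩
      rw [hK] at hKW
      have := congrArg (y ∈ ·) hKW
      simp only [Set.mem_setOf_eq, Finset.mem_coe, eq_iff_iff] at this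
      exact this
  · rintro ⟨hω, W, hW, hiff⟩
    have hK := c1Down_openCluster_obs_eq a₂ o U hω ho
    have hKW : openCluster ω o = ↑W := by
      rw [hK]; ext y; simp only [Set.mem_setOf_eq, Finset.mem_coe]; exact hiff y
    refine ⟨hω, fun h1 => hR W hW ?_, Or.inr ⟨W, hW, hKW⟩⟩
    rw [hKW] at h1; exact_mod_cast h1

/-! ### The pocket event inside `Uᶜ`: dependence, monotonicity -/

/-- The event "the cluster of `o` inside `Uᶜ` is a pocket of `R`" is determined by the pairs
inside `Uᶜ`. [folklore] -/
theorem c1Down_determinedBy_rev (o : Fin n) (U : Finset (Fin n)) (R : Finset (Finset (Fin n))) :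
    DeterminedBy {ω : BondConfig (Fin n) | ∃ W ∈ R, ∀ y : Fin n,
        ω ∈ openConnIn ((↑U : Set (Fin n))ᶜ) o y ↔ y ∈ W}
      (((↑U : Set (Fin n))ᶜ).sym2) :=
  c1Down_determinedBy_pattern
    (fun y => Literature.Probability.Percolation.DCT16.determinedBy_openConnIn _ o y le_rfl)
    (fun χ => ∃ W ∈ R, ∀ y : Fin n, χ y ↔ y ∈ W)

/-- For a DOWN-closed family `R` (every `W' ∋ o` contained in a member is a member), the pocket
event inside `Uᶜ` is decreasing in the configuration (`o ∉ U`). [folklore] -/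
theorem c1Down_isLowerSet_rev (o : Fin n) (U : Finset (Fin n)) (R : Finset (Finset (Fin n)))
    (hdown : ∀ W ∈ R, ∀ W' : Finset (Fin n), o ∈ W' → W' ⊆ W → W' ∈ R) (ho : o ∉ U) :
    IsLowerSet {ω : BondConfig (Fin n) | ∃ W ∈ R, ∀ y : Fin n,
        ω ∈ openConnIn ((↑U : Set (Fin n))ᶜ) o y ↔ y ∈ W} := by
  intro ω ω' hle hω
  obtain ⟨W, hW, hiff⟩ := hω
  refine ⟨Finset.univ.filter fun y => ω' ∈ openConnIn ((↑U : Set (Fin n))ᶜ) o y, ?_, fun y => by simp⟩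
  refine hdown W hW _ ?_ ?_
  · simp only [Finset.mem_filter, Finset.mem_univ, true_and]
    exact Literature.Probability.Percolation.openConnIn_refl (by simpa using ho)
  · intro y hy
    simp only [Finset.mem_filter, Finset.mem_univ, true_and] at hy
    exact (hiff y).1 (Literature.Probability.Percolation.isUpperSet_openConnIn _ o y hle hy)

/-- For a DOWN-closed family `R`, the probability of the pocket event inside `Uᶜ` increases with
`U` (`o ∉ U'`): deleting more vertices shrinks the cluster of `o`. [folklore] -/
theorem c1Down_rev_mono (o : Fin n) {U U' : Finset (Fin n)} (R : Finset (Finset (Fin n)))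
    (hdown : ∀ W ∈ R, ∀ W' : Finset (Fin n), o ∈ W' → W' ⊆ W → W' ∈ R) (hUU' : U ⊆ U')
    (ho : o ∉ U') :
    {ω : BondConfig (Fin n) | ∃ W ∈ R, ∀ y : Fin n,
        ω ∈ openConnIn ((↑U : Set (Fin n))ᶜ) o y ↔ y ∈ W} ⊆
    {ω : BondConfig (Fin n) | ∃ W ∈ R, ∀ y : Fin n,
        ω ∈ openConnIn ((↑U' : Set (Fin n))ᶜ) o y ↔ y ∈ W} := by
  intro ω hω
  obtain ⟨W, hW, hiff⟩ := hω
  refine ⟨Finset.univ.filter fun y => ω ∈ openConnIn ((↑U' : Set (Fin n))ᶜ) o y, ?_, fun y => by simp⟩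
  refine hdown W hW _ ?_ ?_
  · simp only [Finset.mem_filter, Finset.mem_univ, true_and]
    exact Literature.Probability.Percolation.openConnIn_refl (by simpa using ho)
  · intro y hy
    simp only [Finset.mem_filter, Finset.mem_univ, true_and] at hy
    refine (hiff y).1 (c1Down_openConnIn_mono_set ?_ hy)
    exact Set.compl_subset_compl.2 (by exact_mod_cast hUU')


/-- **Registered helper stub `stub_goodStepC1DownRev_k3`** (siege k3, toolkit I): for a DOWN-closed
pocket family `R`, the event "the cluster of `o` inside `Uᶜ` is a pocket of `R`" grows with the
deleted set `U` (`o ∉ U'`) — the monotonicity behind Theorem C1↓. [folklore] -/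
theorem stub_goodStepC1DownRev_k3 :
    ∀ (n : ℕ) (o : Fin n) (U U' : Finset (Fin n)) (R : Finset (Finset (Fin n))),
      (∀ W ∈ R, ∀ W' : Finset (Fin n), o ∈ W' → W' ⊆ W → W' ∈ R) → U ⊆ U' → o ∉ U' →
      {ω : BondConfig (Fin n) | ∃ W ∈ R, ∀ y : Fin n,
          ω ∈ openConnIn ((U : Set (Fin n))ᶜ) o y ↔ y ∈ W} ⊆
      {ω : BondConfig (Fin n) | ∃ W ∈ R, ∀ y : Fin n,
          ω ∈ openConnIn ((U' : Set (Fin n))ᶜ) o y ↔ y ∈ W} :=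
  fun _ o _ _ R hdown hUU' ho => c1Down_rev_mono o R hdown hUU' ho

end PerCluster

end

end Summit.CriticalPhenomena.PercolationContinuityZ3.Theorems
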